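import Summits.SmoothPoincare4.SmoothPoincare4.Theorems.CongruenceShadowsAgkCor6SufficiencyStubSeamFlowMaster

/-!
# Stub `stub_seamFlow` of line `lp-by-sphere-system-surgery` for crux `AgkCor6Sufficiency`
(item stmt-SmoothPoincare4-10894; lead reshape r5b: `SeamFlow9`, SF)

**Transverse unit-speed flows of the seam coordinates** `σ_m = G (refIdx m) - 1` near the seam
pieces `H_m ∖ T(2 r₀)`, explicit in the tube `T(9 r₀)` (`SeamFlow9`, introduced into the tree in
this file: `SeamFlow` of `…SpineDefs.lean` with the clause `tube_form` on `T(9 r₀)` instead of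
`T(10 r₀)`; reshape r5b), from the master flow-box theorem `seamFlow_master`
(`…StubSeamFlowMaster.lean`) with `a = 9 r₀` and the `σ_m`-control `SeamForms.sigma_tube` on
`T(10 r₀)`.  (Milnor's device, h-cobordism theorem, proof of Thm. 3.4: a global vector field with
`dσ_m(ζ) = 1` near the seam piece, glued by a partition of unity from the explicit tube field
`-(1/2p) ∂_q` and local unit-speed fields; its flow, the clock, flow boxes by compactness, and
uniqueness of integral curves in the tube.)

References: Milnor, *Lectures on the h-cobordism theorem* (1965), proof of Thm. 3.4
[MilnorHCobordism1965]; Abrams–Gay–Kirby, Geom. Topol. 22 (2018), proof of Thm. 5 [AbramsGayKirby2018].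
-/

noncomputable section

set_option linter.dupNamespace false

namespace Summit.SmoothPoincare4.SmoothPoincare4.Cruxes.AgkCor6Sufficiency.LpBySphereSystemSurgery

open Set Function Filter
open scoped _root_.Manifold _root_.ContDiff _root_.Topology
open Literature.Topology.FourManifolds

/-! ## The structure `SeamFlow9` (verbatim from the skeleton, reshape r5b) -/

section SeamFlowNine

variable {X : Type} [TopologicalSpace X] [ChartedSpace (EuclideanSpace ℝ (Fin 4)) X]

/-- **`SeamFlow` with the explicit form on the tube `T(9 r₀)`** (lead reshape r5b, after the
seam-flow worker's `stub-misstated`: the registered `SeamFlow.tube_form` on `T(10 r₀)` is not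
obtainable from `SeamForms.sigma_tube`, which pins `σ_m = -2pq` only inside `T(10 r₀)` while
seam points near radius `10 r₀` flow out of it; radius `9 r₀` is, via `seamFlow_master`).  All
other clauses verbatim. -/
structure SeamFlow9 (S : Fin 3 → Set X) (u v : X → ℝ) (ρ : X → X) (Ot : Set X)
    (tp : X → ℝ → ℝ → X) (G : Fin 3 → X → ℝ) (r₀ : ℝ) (N : Fin 3 → Set X) (m : Fin 3)
    (Nf : Set X) (δ : ℝ) (φ : X → ℝ → X) : Prop where
  δ_pos : 0 < δ
  isOpen_Nf : IsOpen Nf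
  Nf_subset : Nf ⊆ N m
  seam_subset : ∀ x ∈ S (m + 1) ∩ S (m + 2), x ∉ tubeSet Ot u v (2 * r₀) → x ∈ Nf
  box_mem : ∀ x ∈ S (m + 1) ∩ S (m + 2), x ∉ tubeSet Ot u v (2 * r₀) → ∀ t ∈ Ioo (-δ) δ, φ x t ∈ Nf
  contMDiffOn : ContMDiffOn ((𝓡 4).prod 𝓘(ℝ, ℝ)) (𝓡 4) ∞ (uncurry φ) (Nf ×ˢ Ioo (-δ) δ)
  mapsTo : ∀ x ∈ Nf, ∀ t ∈ Ioo (-δ) δ, φ x t ∈ N m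
  flow_zero : ∀ x ∈ Nf, φ x 0 = x
  flow_add : ∀ x ∈ Nf, ∀ s t : ℝ, s ∈ Ioo (-δ) δ → t ∈ Ioo (-δ) δ → s + t ∈ Ioo (-δ) δ →
    φ x s ∈ Nf → φ (φ x s) t = φ x (s + t)
  sigma_flow : ∀ x ∈ Nf, ∀ t ∈ Ioo (-δ) δ, G (refIdx m) (φ x t) - 1 = (G (refIdx m) x - 1) + t
  tube_form : ∀ x ∈ Nf, x ∈ tubeSet Ot u v (9 * r₀) → ∀ t ∈ Ioo (-δ) δ,
    φ x t = tp (ρ x)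
      (uOfPQ m (pCo m (u x) (v x)) (qCo m (u x) (v x) - t / (2 * pCo m (u x) (v x))))
      (vOfPQ m (pCo m (u x) (v x)) (qCo m (u x) (v x) - t / (2 * pCo m (u x) (v x))))
  tube_stable : ∀ x ∈ Nf, ∀ t ∈ Ioo (-δ) δ,
    (x ∈ tubeSet Ot u v (9 * r₀) → φ x t ∈ tubeSet Ot u v (10 * r₀)) ∧
    (x ∉ tubeSet Ot u v (9 * r₀) → φ x t ∉ tubeSet Ot u v (8 * r₀))

end SeamFlowNine

/-! ## The statement (verbatim from the skeleton) and its proof -/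

/-- **SF — transverse flows of the seam coordinates** (Milnor's normalised gradient flow of
`σ_m = G (refIdx m) - 1` on `N m`, chosen `Ξ`-explicit in the tube: vector fields with
`dσ_m(ζ) = 1` exist locally, in the tube the explicit field `-(1/2p) ∂_q` qualifies, and the
condition is affine, so a partition of unity globalises; flows and the clock as in
`TrisectionsProductStructure`).  Reshape r5b: concludes with `SeamFlow9` (explicit form on `T(9 r₀)`). -/
def SeamFlowStmt : Prop :=
  ∀ (X : Type) [TopologicalSpace X] [T2Space X] [SecondCountableTopology X]
    [ChartedSpace (EuclideanSpace ℝ (Fin 4)) X] [IsManifold (𝓡 4) ∞ X] [CompactSpace X]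
    (S : Fin 3 → Set X) (u v : X → ℝ) (ρ : X → X) (U O T₀ : Set X) (k : ℕ)
    (Ot : Set X) (rt : ℝ) (tp : X → ℝ → ℝ → X) (G : Fin 3 → X → ℝ) (r₀ ε₁ : ℝ)
    (N : Fin 3 → Set X),
    SpinePresentation S u v ρ U O T₀ G k → TubeStructure (S 0) (⋂ l, S l) u v ρ O Ot rt tp →
    20 * r₀ ≤ rt → SeamForms S u v Ot G r₀ ε₁ N →
    ∀ m : Fin 3, ∃ (Nf : Set X) (δ : ℝ) (φ : X → ℝ → X), SeamFlow9 S u v ρ Ot tp G r₀ N m Nf δ φ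

/-- **Registered stub `stub_seamFlow`** (reshape r5b): `seamFlow_master` with `a = 9 r₀` and
`SeamForms.sigma_tube`. -/
theorem stub_seamFlow : SeamFlowStmt := by
  intro X _ _ _ _ _ _ S u v ρ U O T₀ k Ot rt tp G r₀ ε₁ N hP hTS hrt hSF m
  have h10 : (9 * r₀ + r₀) = 10 * r₀ := by ring
  obtain ⟨Nf, δ, φ, hδ, hNfo, hNfN, hseam, hbox, hsm, hmaps, h0, hadd, hsig, hform, hstab⟩ :=
    seamFlow_master S u v ρ U O T₀ k Ot rt tp G r₀ ε₁ N hP hTS hrt hSF m (9 * r₀) le_rfl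
      (by linarith [hSF.r₀_pos]) (fun x hx hp hq => hSF.sigma_tube m x (by rwa [h10] at hx) hp hq)
  exact ⟨Nf, δ, φ, ⟨hδ, hNfo, hNfN, hseam, hbox, hsm, hmaps, h0, hadd, hsig, hform, hstab⟩⟩

end Summit.SmoothPoincare4.SmoothPoincare4.Cruxes.AgkCor6Sufficiency.LpBySphereSystemSurgery

end
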